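import Mathlib
import Summits.Ventures.PercRepro2.EightTypedStates
import Summits.Ventures.PercRepro2.EightTypedOrbit
import Summits.Ventures.PercRepro2.EightTypedTable

/-!
# Eight typed edges, X.D: the states of a labelling are the cube assignment (blind cell PercRepro2, night-3 g10, 2026-08-26)

`states8_eq_idxList`: the `256` state indices of `states8` at a labelling `f` (with `f 0 = 0`) are the index list of
the cube assignment `S m = stL (gOfB8 f (bits of m) …)` — definitional (one kernel `rfl`, ≈ 5 min; kept in its own
module so that the sorted core stays under the farm's limit).
-/

namespace Summit.Ventures.PercRepro2

open UnionCluster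

namespace CovForm

namespace TwoTyped

open OneTyped TypedRed



section HL8

set_option maxHeartbeats 200000000 in
set_option maxRecDepth 100000 in
/-- the states of the labelling are the index list of the cube assignment (definitional) -/
theorem states8_eq_idxList (f : ℕ → ℕ) (hf0 : f 0 = 0) :
    states8 0 (f 1) (f 2) (f 3) (f 4) (f 5) (f 6) (f 7) (f 8) (f 9) (f 10) (f 11) (f 12) (f 13) (f 14) (f 15) (f 16) (f 17) (f 18) (f 19) (f 20) = idxList8 (fun m => stL (gOfB8 f (m.testBit 0) (m.testBit 1) (m.testBit 2) (m.testBit 3) (m.testBit 4) (m.testBit 5) (m.testBit 6) (m.testBit 7) 0) (gOfB8 f (m.testBit 0) (m.testBit 1) (m.testBit 2) (m.testBit 3) (m.testBit 4) (m.testBit 5) (m.testBit 6) (m.testBit 7) 1) (gOfB8 f (m.testBit 0) (m.testBit 1) (m.testBit 2) (m.testBit 3) (m.testBit 4) (m.testBit 5) (m.testBit 6) (m.testBit 7) 2) (gOfB8 f (m.testBit 0) (m.testBit 1) (m.testBit 2) (m.testBit 3) (m.testBit 4) (m.testBit 5) (m.testBit 6) (m.testBit 7) 3) (gOfB8 f (m.testBit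 0) (m.testBit 1) (m.testBit 2) (m.testBit 3) (m.testBit 4) (m.testBit 5) (m.testBit 6) (m.testBit 7) 4)) := by
  have hl : states8 (f 0) (f 1) (f 2) (f 3) (f 4) (f 5) (f 6) (f 7) (f 8) (f 9) (f 10) (f 11) (f 12) (f 13) (f 14) (f 15) (f 16) (f 17) (f 18) (f 19) (f 20) = idxList8 (fun m => stL (gOfB8 f (m.testBit 0) (m.testBit 1) (m.testBit 2) (m.testBit 3) (m.testBit 4) (m.testBit 5) (m.testBit 6) (m.testBit 7) 0) (gOfB8 f (m.testBit 0) (m.testBit 1) (m.testBit 2) (m.testBit 3) (m.testBit 4) (m.testBit 5) (m.testBit 6) (m.testBit 7) 1) (gOfB8 f (m.testBit 0) (m.testBit 1) (m.testBit 2) (m.testBit 3) (m.testBit 4) (m.testBit 5) (m.testBit 6) (m.testBit 7) 2) (gOfB8 f (m.testBit 0) (m.testBit 1) (m.testBit 2) (m.testBit 3) (m.testBit 4) (m.testBit 5) (m.testBit 6) (m.testBit 7) 3) (gOfB8 f (m.testBit 0) (m.testBit 1) (m.testBit 2) (m.testBit 3) (m.testBit 4) (m.testBit 5) (m.testBit 6)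 (m.testBit 7) 4)) := rfl
  rw [hf0] at hl
  exact hl

end HL8

end TwoTyped

end CovForm

end Summit.Ventures.PercRepro2
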